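import Mathlib
import HarnessLib
import Summits.HubbardSuperconductivity.HubbardSuperconductivity.Theorems.KLProgrammeC4aVertexSecondOrderSplit

/-!
# Route `KLProgramme` — crux C4a, S1 (d): THE SECOND-ORDER TADPOLE VERTEX AT ALL CONTINUUM MOMENTA — the pp bubble is EXACTLY a function of `P + q`,
# the ph-crossed bubble a character polynomial in `(P, −q)`, the trees one-slot character polynomials

Cell `gate-hubbard-kl`, lane hubbard-kl-c4a-1 (g6); helper for stub (C) `stub_twoLeg_curvature` of the engine-flow child `KLRegimeEngineV17F2`
(stmt-HubbardSuperconductivity-20437); memo HOME/hubbard-kl-c4a-1/C4A-PLAN.md §23.3 (d1).  `…C4aSecondCumulantTadpoleLegs.tadpoleVertex_secondCumulant_latticeMomentum`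
gives the continuum tadpole vertex `V^{(2)} = tadpoleVertex β (e^{Δ_C}(WW) − (e^{Δ_C}W)²) p₀` of the second cumulant at LATTICE momenta as lattice loop sums: a pp bubble
`S_pp` read at `k⃗ + q⃗`, a ph-crossed bubble `S_ph` read at `k⃗ − q⃗`, a constant and two one-slot trees.  `V^{(2)}` is a canonical character polynomial in each slot
(`…C4aBareTadpoleVertex.isCharPoly_tadpoleVertex_ext/_loop`), so UNIQUENESS FROM THE LATTICE (`IsCharPoly.eq_of_eq_latticeMomentum`, twice) continues the
formula to ALL continuum `(P, q)` once each piece is written as a double character polynomial agreeing on the lattice: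

* §1 torus Fourier coefficients `F̌(x) = L⁻²Σ_R F(R)χ_R(−x)` and inversion `Σ_x F̌(x)χ_R(x) = F(R)` (`sum_latticeCoeff_mul_torusChar`); the plane wave
  `E(P,x) = e^{iΣ_j P_j x̃_j}` at a lattice momentum is the character (`torusChar_eq_cexp_valMinAbs`);
* §2 **`tadpoleVertex_secondCumulant_continuum`** (`β ≠ 0`, `contr C = diagContr ℓ`; all `P q : Fin 2 → ℝ`):
  `V^{(2)}(P,q) = 6βL⁴·Σ_κ [96c_U²·(Σ_pℓ² − Σ_x Š_pp,κ(x)E(P,x)E(q,x) − 2·Σ_x Š_ph,κ(x)E(P,x)E(q,−x)) − 8c_U·(Σ_x Ť_κ(x)E(P,x) + Σ_x Ť_Q(x)E(q,x))]`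
  — the pp piece is `Σ_x Š_pp(x)e^{i(P+q)·x̃} = charPoly univ Š_pp id (P + q)` EXACTLY (a function of `P + q` alone: the input shape `V k q = B(k+q)` of
  `…C4aCoMovingJetsL1Sum.coMovingJetsL1_of_classDecomposition`); the ph piece carries `e^{iq·(−x)~}` (`= e^{−iq·x̃}` off the Nyquist layer, i.e. a function of `P − q`
  exactly when `L` is odd); the trees are θ-only / q-only.

Exact algebra; nothing about sizes; nothing asserts superconductivity.  References: BGM 2006 §2.3 (2.17) [cite: BenfattoGiulianiMastropietro2006]; Zygmund, Trigonometric
Series, Ch. X §2 (interpolation) [cite: Zygmund2002].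
-/

noncomputable section

namespace Summit.HubbardSuperconductivity.HubbardSuperconductivity.Theorems.C4a

set_option linter.dupNamespace false -- summit = problem name (single-conjunct summit), D-0017

open Literature.MathematicalPhysics.QuantumLattice Literature.Probability.LatticeModels GrassmannAlgebra Finset Matrix
open Summit.HubbardSuperconductivity.HubbardSuperconductivity.Theorems.KLRegimeWick
open Summit.HubbardSuperconductivity.HubbardSuperconductivity.Theorems.KLRegimeSplit
open Summit.HubbardSuperconductivity.HubbardSuperconductivity.Theorems.KLProgrammeLegKernels
open Summit.HubbardSuperconductivity.HubbardSuperconductivity.Theorems.TwoPointAssembly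

variable {L M : ℕ} [NeZero L]

/-! ## §1 Torus Fourier coefficients of a lattice function; plane waves at lattice momenta -/

/-- **Inversion**: with `F̌(x) = L⁻²·Σ_R F(R)·χ_R(−x)`, `Σ_x F̌(x)·χ_S(x) = F(S)`. [cite: Zygmund2002, Ch. X §2] -/
theorem sum_latticeCoeff_mul_torusChar (F : TorusSite 2 L → ℂ) (S : TorusSite 2 L) :
    ∑ x : TorusSite 2 L, (((L : ℂ) ^ 2)⁻¹ * ∑ R : TorusSite 2 L, F R * torusChar R (-x)) * torusChar S x = F S := by
  have hL : ((L : ℂ) ^ 2) ≠ 0 := pow_ne_zero _ (Nat.cast_ne_zero.2 (NeZero.ne L))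
  have h : ∀ x : TorusSite 2 L, (((L : ℂ) ^ 2)⁻¹ * ∑ R : TorusSite 2 L, F R * torusChar R (-x)) * torusChar S x =
      ((L : ℂ) ^ 2)⁻¹ * ∑ R : TorusSite 2 L, F R * (torusChar x (-R) * torusChar x S) := by
    intro x
    rw [mul_assoc, Finset.sum_mul]
    refine congrArg _ (Finset.sum_congr rfl fun R _ => ?_)
    rw [torusChar_neg_right_eq_neg_left, torusChar_comm (-R) x, torusChar_comm S x, mul_assoc]
  simp_rw [h]
  rw [← Finset.mul_sum, Finset.sum_comm]
  simp_rw [← Finset.mul_sum, sum_torusChar_mul_torusChar, neg_neg]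
  rw [Finset.sum_eq_single S (fun R _ hR => by rw [if_neg (Ne.symm hR), mul_zero]) (fun h => absurd (Finset.mem_univ S) h), if_pos rfl,
    ← mul_assoc, mul_comm, ← mul_assoc, mul_inv_cancel₀ hL, one_mul]

/-- The plane wave with centred frequencies at a lattice momentum is the character. -/
theorem cexp_latticeMomentum_valMinAbs (k x : TorusSite 2 L) :
    Complex.exp (((∑ j, latticeMomentum L k j * ((x j).valMinAbs : ℝ) : ℝ) : ℂ) * Complex.I) = torusChar k x :=
  (torusChar_eq_cexp_valMinAbs k x).symm

omit [NeZero L] in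
/-- The plane wave is additive in the momentum: `E(P + Q, x) = E(P,x)·E(Q,x)`. -/
theorem cexp_add_valMinAbs (P Q : Fin 2 → ℝ) (x : TorusSite 2 L) :
    Complex.exp (((∑ j, (P j + Q j) * ((x j).valMinAbs : ℝ) : ℝ) : ℂ) * Complex.I) =
      Complex.exp (((∑ j, P j * ((x j).valMinAbs : ℝ) : ℝ) : ℂ) * Complex.I) * Complex.exp (((∑ j, Q j * ((x j).valMinAbs : ℝ) : ℝ) : ℂ) * Complex.I) := by
  rw [← Complex.exp_add]
  congr 1
  simp_rw [add_mul, Finset.sum_add_distrib]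
  push_cast
  ring

/-- **pp piece at lattice momenta**: `Σ_x F̌(x)·E(p_k,x)·E(p_q,x) = F(k + q)`. -/
theorem sum_latticeCoeff_cexp_cexp_latticeMomentum (F : TorusSite 2 L → ℂ) (k q₀ : TorusSite 2 L) :
    ∑ x : TorusSite 2 L, (((L : ℂ) ^ 2)⁻¹ * ∑ R : TorusSite 2 L, F R * torusChar R (-x)) *
        Complex.exp (((∑ j, latticeMomentum L k j * ((x j).valMinAbs : ℝ) : ℝ) : ℂ) * Complex.I) *
          Complex.exp (((∑ j, latticeMomentum L q₀ j * ((x j).valMinAbs : ℝ) : ℝ) : ℂ) * Complex.I) = F (k + q₀) := by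
  simp_rw [cexp_latticeMomentum_valMinAbs, mul_assoc, ← torusChar_add_left, ← mul_assoc]
  exact sum_latticeCoeff_mul_torusChar F (k + q₀)

/-- **ph piece at lattice momenta**: `Σ_x Ǧ(x)·E(p_k,x)·E(p_q,−x) = G(k − q)`. -/
theorem sum_latticeCoeff_cexp_cexp_neg_latticeMomentum (G : TorusSite 2 L → ℂ) (k q₀ : TorusSite 2 L) :
    ∑ x : TorusSite 2 L, (((L : ℂ) ^ 2)⁻¹ * ∑ D : TorusSite 2 L, G D * torusChar D (-x)) *
        Complex.exp (((∑ j, latticeMomentum L k j * ((x j).valMinAbs : ℝ) : ℝ) : ℂ) * Complex.I) *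
          Complex.exp (((∑ j, latticeMomentum L q₀ j * (((-x) j).valMinAbs : ℝ) : ℝ) : ℂ) * Complex.I) = G (k - q₀) := by
  have hneg : ∀ x : TorusSite 2 L, Complex.exp (((∑ j, latticeMomentum L q₀ j * (((-x) j).valMinAbs : ℝ) : ℝ) : ℂ) * Complex.I) = torusChar (-q₀) x :=
    fun x => by rw [cexp_latticeMomentum_valMinAbs q₀ (-x), torusChar_neg_right_eq_neg_left]
  simp_rw [hneg, cexp_latticeMomentum_valMinAbs, mul_assoc, ← torusChar_add_left, ← mul_assoc, ← sub_eq_add_neg]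
  exact sum_latticeCoeff_mul_torusChar G (k - q₀)

/-- **One-slot piece at a lattice momentum**: `Σ_x Ť(x)·E(p_k,x) = T(k)`. -/
theorem sum_latticeCoeff_cexp_latticeMomentum (T : TorusSite 2 L → ℂ) (k : TorusSite 2 L) :
    ∑ x : TorusSite 2 L, (((L : ℂ) ^ 2)⁻¹ * ∑ k' : TorusSite 2 L, T k' * torusChar k' (-x)) *
        Complex.exp (((∑ j, latticeMomentum L k j * ((x j).valMinAbs : ℝ) : ℝ) : ℂ) * Complex.I) = T k := by
  simp_rw [cexp_latticeMomentum_valMinAbs]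
  exact sum_latticeCoeff_mul_torusChar T k

/-- A two-slot character sum is a canonical character polynomial in the first slot. -/
theorem isCharPoly_sum_mul_cexp_left (a : TorusSite 2 L → ℂ) (e : TorusSite 2 L → ℂ) :
    IsCharPoly L fun P : Fin 2 → ℝ => ∑ x : TorusSite 2 L, a x * Complex.exp (((∑ j, P j * ((x j).valMinAbs : ℝ) : ℝ) : ℂ) * Complex.I) * e x :=
  ⟨fun x => a x * e x, fun P => Finset.sum_congr rfl fun x _ => by ring⟩

/-- … and in the second slot. -/
theorem isCharPoly_sum_mul_cexp_right (a : TorusSite 2 L → ℂ) :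
    IsCharPoly L fun q : Fin 2 → ℝ => ∑ x : TorusSite 2 L, a x * Complex.exp (((∑ j, q j * ((x j).valMinAbs : ℝ) : ℝ) : ℂ) * Complex.I) :=
  ⟨a, fun _ => rfl⟩

/-- The ph piece in the loop slot: reindex `x ↦ −x` to expose the frequencies `z̃`. -/
theorem isCharPoly_sum_mul_cexp_neg_right (a : TorusSite 2 L → ℂ) :
    IsCharPoly L fun q : Fin 2 → ℝ => ∑ x : TorusSite 2 L, a x * Complex.exp (((∑ j, q j * (((-x) j).valMinAbs : ℝ) : ℝ) : ℂ) * Complex.I) := by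
  refine ⟨fun z => a (-z), fun _ => ?_⟩
  exact Fintype.sum_equiv (Equiv.neg (TorusSite 2 L)) _ _ fun x => by simp only [Equiv.neg_apply, neg_neg]

/-! ## §2 The second-order vertex at all continuum momenta -/

section Continuum

variable [NeZero M] (U : ℝ) (K : TrigPolyC4v) {C : Matrix (HubbardFieldIdx L M) (HubbardFieldIdx L M) ℂ} {ℓ : FreqMomentum L M → ℂ}

/-- **THE SECOND-ORDER TADPOLE VERTEX AT ALL CONTINUUM MOMENTA** (`β ≠ 0`, `contr C = diagContr ℓ`; for the scale-`n` action `C = klHardCov … n`,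
`ℓ = χ_{Λ_n}·βL²·ĝ_K` by `contr_klHardCov_eq_diagContr`).  With `E(P,x) = e^{iΣ_j P_j x̃_j}`, the external frequency `κ ∈ {ω₀, −ω₀}`, the loop label `Q = (p₀, ·)`,
the lattice bubbles `S_pp,κ(R) = Σ_{p,p′}[n_p+n_p′ = n_κ+n_{p₀} ∧ p⃗+p⃗′ = R]ℓℓ′`, `S_ph,κ(D) = Σ_{p,p′}[n_p+n_{p₀} = n_p′+n_κ ∧ p⃗ = p⃗′ + D]ℓℓ′`, the trees
`T_κ(k⃗) = ℓ(κ,k⃗)·Σ_sΣ̃((κ,k⃗),s)`, `T_Q(q⃗) = ℓ(p₀,q⃗)·Σ_sΣ̃((p₀,q⃗),s)` (`Σ̃ = kernel W̃ 2 (ψ̂⁺,ψ̂⁻)`), and `F̌(x) = L⁻²Σ_R F(R)χ_R(−x)`: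
`tadpoleVertex β cum p₀ P q = 6βL⁴·Σ_κ [96c_U²·(Σ_pℓ(p)² − Σ_x Š_pp,κ(x)E(P,x)E(q,x) − 2Σ_x Š_ph,κ(x)E(P,x)E(q,−x)) − 8c_U·(Σ_x Ť_κ(x)E(P,x) + Σ_x Ť_Q(x)E(q,x))]`
for ALL `P q : Fin 2 → ℝ` — the pp piece is a function of `P + q` alone (`E(P,x)E(q,x) = E(P+q,x)`). [cite: BenfattoGiulianiMastropietro2006, §2.3 (2.17)] -/
theorem tadpoleVertex_secondCumulant_continuum {β : ℝ} (hβ : β ≠ 0) (hC : contr ℂ C = diagContr L M ℓ) (p₀ : MatsubaraIdx M) (P q : Fin 2 → ℝ) :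
    tadpoleVertex β (gaussConv ℂ C (hubbardInteractionCT L M β U K * hubbardInteractionCT L M β U K) -
        gaussConv ℂ C (hubbardInteractionCT L M β U K) * gaussConv ℂ C (hubbardInteractionCT L M β U K)) p₀ (WithLp.toLp 2 P) (WithLp.toLp 2 q) =
      ((6 * β * (L : ℝ) ^ 4 : ℝ) : ℂ) * ∑ κ : Fin 2,
        (96 * ((((U / (β * (L : ℝ) ^ 2) ^ 3 : ℝ)) : ℂ) * (((4 : ℕ).factorial : ℚ)⁻¹ • (1 : ℂ))) ^ 2 *
            (∑ p : FreqMomentum L M, ℓ p * ℓ p -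
              ∑ x : TorusSite 2 L, (((L : ℂ) ^ 2)⁻¹ * ∑ R : TorusSite 2 L,
                  (∑ p : FreqMomentum L M, ∑ p' : FreqMomentum L M,
                    if matsubaraInt M p.1 + matsubaraInt M p'.1 =
                        matsubaraInt M ((![omega0 M, (omega0 M).rev] : Fin 2 → MatsubaraIdx M) κ) + matsubaraInt M p₀ ∧ p.2 + p'.2 = R then ℓ p * ℓ p' else 0) *
                  torusChar R (-x)) *
                Complex.exp (((∑ j, P j * ((x j).valMinAbs : ℝ) : ℝ) : ℂ) * Complex.I) * Complex.exp (((∑ j, q j * ((x j).valMinAbs : ℝ) : ℝ) : ℂ) * Complex.I) -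
              2 * ∑ x : TorusSite 2 L, (((L : ℂ) ^ 2)⁻¹ * ∑ D : TorusSite 2 L,
                  (∑ p : FreqMomentum L M, ∑ p' : FreqMomentum L M,
                    if matsubaraInt M p.1 + matsubaraInt M p₀ = matsubaraInt M p'.1 + matsubaraInt M ((![omega0 M, (omega0 M).rev] : Fin 2 → MatsubaraIdx M) κ) ∧
                        p.2 = p'.2 + D then ℓ p * ℓ p' else 0) *
                  torusChar D (-x)) *
                Complex.exp (((∑ j, P j * ((x j).valMinAbs : ℝ) : ℝ) : ℂ) * Complex.I) *
                  Complex.exp (((∑ j, q j * (((-x) j).valMinAbs : ℝ) : ℝ) : ℂ) * Complex.I)) -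
          8 * ((((U / (β * (L : ℝ) ^ 2) ^ 3 : ℝ)) : ℂ) * (((4 : ℕ).factorial : ℚ)⁻¹ • (1 : ℂ))) *
            (∑ x : TorusSite 2 L, (((L : ℂ) ^ 2)⁻¹ * ∑ k : TorusSite 2 L,
                (ℓ (((![omega0 M, (omega0 M).rev] : Fin 2 → MatsubaraIdx M) κ), k) *
                  ∑ s : Fin 2, kernel ℂ (gaussConv ℂ C (hubbardInteractionCT L M β U K)) 2
                    ![(((((![omega0 M, (omega0 M).rev] : Fin 2 → MatsubaraIdx M) κ), k), s), 0),
                      (((((![omega0 M, (omega0 M).rev] : Fin 2 → MatsubaraIdx M) κ), k), s), 1)]) * torusChar k (-x)) *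
                Complex.exp (((∑ j, P j * ((x j).valMinAbs : ℝ) : ℝ) : ℂ) * Complex.I) +
              ∑ x : TorusSite 2 L, (((L : ℂ) ^ 2)⁻¹ * ∑ k : TorusSite 2 L,
                (ℓ (p₀, k) * ∑ s : Fin 2, kernel ℂ (gaussConv ℂ C (hubbardInteractionCT L M β U K)) 2 ![(((p₀, k), s), 0), (((p₀, k), s), 1)]) * torusChar k (-x)) *
                Complex.exp (((∑ j, q j * ((x j).valMinAbs : ℝ) : ℝ) : ℂ) * Complex.I))) := by
  -- the right-hand side is a canonical character polynomial in each slot (explicitly typed, so that uniqueness applies by `rfl`-matching)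
  have hRP : ∀ q' : Fin 2 → ℝ, IsCharPoly L fun P' : Fin 2 → ℝ =>
        ((6 * β * (L : ℝ) ^ 4 : ℝ) : ℂ) * ∑ κ : Fin 2,
          (96 * ((((U / (β * (L : ℝ) ^ 2) ^ 3 : ℝ)) : ℂ) * (((4 : ℕ).factorial : ℚ)⁻¹ • (1 : ℂ))) ^ 2 *
              (∑ p : FreqMomentum L M, ℓ p * ℓ p -
                ∑ x : TorusSite 2 L, (((L : ℂ) ^ 2)⁻¹ * ∑ R : TorusSite 2 L,
                    (∑ p : FreqMomentum L M, ∑ p' : FreqMomentum L M,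
                      if matsubaraInt M p.1 + matsubaraInt M p'.1 =
                          matsubaraInt M ((![omega0 M, (omega0 M).rev] : Fin 2 → MatsubaraIdx M) κ) + matsubaraInt M p₀ ∧ p.2 + p'.2 = R then ℓ p * ℓ p' else 0) *
                    torusChar R (-x)) *
                  Complex.exp (((∑ j, P' j * ((x j).valMinAbs : ℝ) : ℝ) : ℂ) * Complex.I) * Complex.exp (((∑ j, q' j * ((x j).valMinAbs : ℝ) : ℝ) : ℂ) * Complex.I) -
                2 * ∑ x : TorusSite 2 L, (((L : ℂ) ^ 2)⁻¹ * ∑ D : TorusSite 2 L,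
                    (∑ p : FreqMomentum L M, ∑ p' : FreqMomentum L M,
                      if matsubaraInt M p.1 + matsubaraInt M p₀ = matsubaraInt M p'.1 + matsubaraInt M ((![omega0 M, (omega0 M).rev] : Fin 2 → MatsubaraIdx M) κ) ∧
                          p.2 = p'.2 + D then ℓ p * ℓ p' else 0) *
                    torusChar D (-x)) *
                  Complex.exp (((∑ j, P' j * ((x j).valMinAbs : ℝ) : ℝ) : ℂ) * Complex.I) *
                    Complex.exp (((∑ j, q' j * (((-x) j).valMinAbs : ℝ) : ℝ) : ℂ) * Complex.I)) -
            8 * ((((U / (β * (L : ℝ) ^ 2) ^ 3 : ℝ)) : ℂ) * (((4 : ℕ).factorial : ℚ)⁻¹ • (1 : ℂ))) *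
              (∑ x : TorusSite 2 L, (((L : ℂ) ^ 2)⁻¹ * ∑ k : TorusSite 2 L,
                  (ℓ (((![omega0 M, (omega0 M).rev] : Fin 2 → MatsubaraIdx M) κ), k) *
                    ∑ s : Fin 2, kernel ℂ (gaussConv ℂ C (hubbardInteractionCT L M β U K)) 2
                      ![(((((![omega0 M, (omega0 M).rev] : Fin 2 → MatsubaraIdx M) κ), k), s), 0),
                        (((((![omega0 M, (omega0 M).rev] : Fin 2 → MatsubaraIdx M) κ), k), s), 1)]) * torusChar k (-x)) *
                  Complex.exp (((∑ j, P' j * ((x j).valMinAbs : ℝ) : ℝ) : ℂ) * Complex.I) +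
                ∑ x : TorusSite 2 L, (((L : ℂ) ^ 2)⁻¹ * ∑ k : TorusSite 2 L,
                  (ℓ (p₀, k) * ∑ s : Fin 2, kernel ℂ (gaussConv ℂ C (hubbardInteractionCT L M β U K)) 2 ![(((p₀, k), s), 0), (((p₀, k), s), 1)]) * torusChar k (-x)) *
                  Complex.exp (((∑ j, q' j * ((x j).valMinAbs : ℝ) : ℝ) : ℂ) * Complex.I))) := fun q' => by
    refine (IsCharPoly.sum _ fun κ => ?_).const_mul _
    exact ((((isCharPoly_const _).sub (isCharPoly_sum_mul_cexp_left _ _)).sub ((isCharPoly_sum_mul_cexp_left _ _).const_mul 2)).const_mul _).sub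
      (((isCharPoly_sum_mul_cexp_right _).add (isCharPoly_const _)).const_mul _)
  have hRq : ∀ P' : Fin 2 → ℝ, IsCharPoly L fun q' : Fin 2 → ℝ =>
        ((6 * β * (L : ℝ) ^ 4 : ℝ) : ℂ) * ∑ κ : Fin 2,
          (96 * ((((U / (β * (L : ℝ) ^ 2) ^ 3 : ℝ)) : ℂ) * (((4 : ℕ).factorial : ℚ)⁻¹ • (1 : ℂ))) ^ 2 *
              (∑ p : FreqMomentum L M, ℓ p * ℓ p -
                ∑ x : TorusSite 2 L, (((L : ℂ) ^ 2)⁻¹ * ∑ R : TorusSite 2 L,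
                    (∑ p : FreqMomentum L M, ∑ p' : FreqMomentum L M,
                      if matsubaraInt M p.1 + matsubaraInt M p'.1 =
                          matsubaraInt M ((![omega0 M, (omega0 M).rev] : Fin 2 → MatsubaraIdx M) κ) + matsubaraInt M p₀ ∧ p.2 + p'.2 = R then ℓ p * ℓ p' else 0) *
                    torusChar R (-x)) *
                  Complex.exp (((∑ j, P' j * ((x j).valMinAbs : ℝ) : ℝ) : ℂ) * Complex.I) * Complex.exp (((∑ j, q' j * ((x j).valMinAbs : ℝ) : ℝ) : ℂ) * Complex.I) -
                2 * ∑ x : TorusSite 2 L, (((L : ℂ) ^ 2)⁻¹ * ∑ D : TorusSite 2 L,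
                    (∑ p : FreqMomentum L M, ∑ p' : FreqMomentum L M,
                      if matsubaraInt M p.1 + matsubaraInt M p₀ = matsubaraInt M p'.1 + matsubaraInt M ((![omega0 M, (omega0 M).rev] : Fin 2 → MatsubaraIdx M) κ) ∧
                          p.2 = p'.2 + D then ℓ p * ℓ p' else 0) *
                    torusChar D (-x)) *
                  Complex.exp (((∑ j, P' j * ((x j).valMinAbs : ℝ) : ℝ) : ℂ) * Complex.I) *
                    Complex.exp (((∑ j, q' j * (((-x) j).valMinAbs : ℝ) : ℝ) : ℂ) * Complex.I)) -
            8 * ((((U / (β * (L : ℝ) ^ 2) ^ 3 : ℝ)) : ℂ) * (((4 : ℕ).factorial : ℚ)⁻¹ • (1 : ℂ))) *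
              (∑ x : TorusSite 2 L, (((L : ℂ) ^ 2)⁻¹ * ∑ k : TorusSite 2 L,
                  (ℓ (((![omega0 M, (omega0 M).rev] : Fin 2 → MatsubaraIdx M) κ), k) *
                    ∑ s : Fin 2, kernel ℂ (gaussConv ℂ C (hubbardInteractionCT L M β U K)) 2
                      ![(((((![omega0 M, (omega0 M).rev] : Fin 2 → MatsubaraIdx M) κ), k), s), 0),
                        (((((![omega0 M, (omega0 M).rev] : Fin 2 → MatsubaraIdx M) κ), k), s), 1)]) * torusChar k (-x)) *
                  Complex.exp (((∑ j, P' j * ((x j).valMinAbs : ℝ) : ℝ) : ℂ) * Complex.I) +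
                ∑ x : TorusSite 2 L, (((L : ℂ) ^ 2)⁻¹ * ∑ k : TorusSite 2 L,
                  (ℓ (p₀, k) * ∑ s : Fin 2, kernel ℂ (gaussConv ℂ C (hubbardInteractionCT L M β U K)) 2 ![(((p₀, k), s), 0), (((p₀, k), s), 1)]) * torusChar k (-x)) *
                  Complex.exp (((∑ j, q' j * ((x j).valMinAbs : ℝ) : ℝ) : ℂ) * Complex.I))) := fun P' => by
    refine (IsCharPoly.sum _ fun κ => ?_).const_mul _
    exact ((((isCharPoly_const _).sub (isCharPoly_sum_mul_cexp_right _)).sub ((isCharPoly_sum_mul_cexp_neg_right _).const_mul 2)).const_mul _).sub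
      (((isCharPoly_const _).add (isCharPoly_sum_mul_cexp_right _)).const_mul _)
  -- continue off the lattice twice (`IsCharPoly.eq_of_eq_latticeMomentum`): the loop slot at fixed `P`, after the external slot at lattice loop momenta
  refine (isCharPoly_tadpoleVertex_loop (L := L) (M := M) β _ p₀ (WithLp.toLp 2 P)).eq_of_eq_latticeMomentum (hRq P) (fun q₀ => ?_) q
  refine (isCharPoly_tadpoleVertex_ext (L := L) (M := M) β _ p₀ _).eq_of_eq_latticeMomentum (hRP (latticeMomentum L q₀)) (fun k => ?_) P
  -- at a pair of lattice momenta: `…C4aSecondCumulantTadpoleLegs` + Fourier inversion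
  rw [tadpoleVertex_secondCumulant_latticeMomentum U K hβ hC p₀ k q₀]
  congr 1
  refine Finset.sum_congr rfl fun κ _ => ?_
  rw [sum_latticeCoeff_cexp_cexp_latticeMomentum, sum_latticeCoeff_cexp_cexp_neg_latticeMomentum, sum_latticeCoeff_cexp_latticeMomentum,
    sum_latticeCoeff_cexp_latticeMomentum]
  -- the ph constraint `p⃗ + q⃗₀ = p⃗′ + k⃗` is `p⃗ = p⃗′ + (k⃗ − q⃗₀)`
  have hcon : ∀ a b : TorusSite 2 L, (a + q₀ = b + k) ↔ (a = b + (k - q₀)) := fun a b => by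
    constructor
    · intro h; rw [← add_sub_assoc, ← h, add_sub_cancel_right]
    · intro h; rw [h, add_assoc, sub_add_cancel]
  simp only [hcon]

end Continuum

end Summit.HubbardSuperconductivity.HubbardSuperconductivity.Theorems.C4a

end
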